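import Summits.ABC.ABC.Theses.IneffectiveSubspace
import Summits.ABC.ABC.Theorems.IneffectiveSubspaceUniformSadicGivesTowerFour
import Summits.ABC.ABC.Theorems.IneffectiveSubspaceTowerFourGivesDepthCounted

/-!
# `UniformSadicTowerFour` (stmt-ABC-14937), line `Sketch`: the level-one rung at budget `K ≤ 1`

The stub `stub_levelOneRung_one` of the line `Sketch` (card `mixed-radical-exchange-map`).

**Statement.** For every `ε > 0` there is `C > 0` (in fact `C = 2` serves for every `ε`) such
that for every set `S` of at most ONE prime and every abc triple `(a, b, c)` (`0 < a`, `0 < b`,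
`a + b = c`, `Coprime a b`) one has `c < C · ((∏_{p ∈ S} p) · {abc}^S)^(1+ε)`, where
`{m}^S := ∏_{r ∣ m, r ∉ S} r^{v_r(m)}` is the `S`-free part of `m` ("uniform Mahler–Ridout with
linear `S`-loss" at budget `1`; the rung first becomes hard at `K = 2`, where it contains prime
Hall).

**Proof.** It suffices to prove the integer inequality `c ≤ B := (∏_{p ∈ S} p) · {abc}^S`, for
then `c < 2c ≤ 2B ≤ 2 B^(1+ε)` (`B ≥ c ≥ 1`). If `S = ∅` then `B = abc ≥ c` (unique
factorisation). If `S = {p}` then `B = p · T` with `T · p^{v_p(abc)} = abc` (split the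
factorisation of `abc` at `p`; if `p ∤ abc` then `v_p(abc) = 0` and `T = abc`), so the claim is
`c · p^{v_p(abc)} ≤ p · abc`. Since `a, b, c` are pairwise coprime,
`v_p(abc) = v_p(a) + v_p(b) + v_p(c)` has at most one nonzero summand, whence
`p^{v_p(abc)} ≤ a`, `≤ b` or `≤ c` (`p^{v_p(n)} ∣ n`). In
the first two cases `c · p^{v_p(abc)} ≤ c · a ≤ p · abc` (resp. `c · b`); in the third
`c · p^{v_p(abc)} ≤ c² ≤ c · 2ab ≤ p · abc` because `c = a + b ≤ 2ab` and `p ≥ 2`.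

Sources: card mixed-radical-exchange-map (crux stmt-ABC-14937, line Sketch), item LevelOneRung /
ElementaryStrata. Mathlib only (`Nat.ordProj_le`, `Nat.factorization_mul`,
`Nat.prod_factorization_pow_eq_self`, `Finset.prod_erase_mul`, `Real.self_le_rpow_of_one_le`) plus
the landed `UniformSadicGivesTowerFour.bracket_empty` (the `S = ∅` bracket) and
`TowerFourGivesDepthCounted.factorization_eq_zero_or`. Deliberately NOT here: the other stubs of the
line.
-/

-- `Summit.<Summit>.<Problem>` is the mandated summit-side namespace (CONVENTIONS §2); for the
-- single-conjunct summit `ABC` the two coincide, so the duplicate `ABC.ABC` is deliberate.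
set_option linter.dupNamespace false

namespace Summit.ABC.ABC.Theorems.UniformSadicTowerFour.MixedRadical

open Literature.NumberTheory.DiophantineGeometry (IsABCTriple rad rad_def)
open Summit.ABC.ABC.Theses.IneffectiveSubspace
open scoped BigOperators

/-! ## Unique factorisation split at one prime -/

/-- **The factorisation split at one prime:** for `M ≠ 0` and any `p`,
`(∏_{r ∣ M, r ≠ p} r^{v_r(M)}) · p^{v_p(M)} = M` (unique factorisation `∏_{r ∣ M} r^{v_r(M)} = M`,
split at `p`; if `p ∤ M` the exponent is `0`). [folklore] -/
theorem levelOneOne_sdiff_singleton_mul {M : ℕ} (hM : M ≠ 0) (p : ℕ) :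
    (∏ r ∈ M.primeFactors \ {p}, r ^ M.factorization r) * p ^ M.factorization p = M := by
  have hfull : ∏ r ∈ M.primeFactors, r ^ M.factorization r = M := by
    conv_rhs => rw [← Nat.prod_factorization_pow_eq_self hM,
      Nat.prod_factorization_eq_prod_primeFactors]
  rw [Finset.sdiff_singleton_eq_erase]
  by_cases hp : p ∈ M.primeFactors
  · rwa [Finset.prod_erase_mul _ _ hp]
  · have h0 : M.factorization p = 0 := by
      rwa [← Finsupp.notMem_support_iff, Nat.support_factorization]
    rwa [h0, pow_zero, mul_one, Finset.erase_eq_of_notMem hp]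

/-! ## The key integer inequality -/

/-- **Key inequality:** for an abc triple `(a, b, c)` and a prime `p`,
`c · p^{v_p(abc)} ≤ p · abc`. Pairwise coprimality puts `p^{v_p(abc)}` below one of `a, b, c`;
then `c · a ≤ p · abc`, `c · b ≤ p · abc`, and `c · c ≤ c · 2ab ≤ p · abc`. [folklore] -/
theorem levelOneOne_key {a b c p : ℕ} (habc : IsABCTriple a b c) (hp : p.Prime) :
    c * p ^ (a * b * c).factorization p ≤ p * (a * b * c) := by
  obtain ⟨ha, hb, hsum, hcop⟩ := habc
  have hc : c ≠ 0 := by omega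
  have hac : Nat.Coprime a c := by
    rw [← hsum]
    exact Nat.coprime_self_add_right.mpr hcop
  have hbc : Nat.Coprime b c := by
    rw [← hsum]
    exact Nat.coprime_add_self_right.mpr hcop.symm
  have ha1 : 1 ≤ a := ha
  have hb1 : 1 ≤ b := hb
  have hc1 : 1 ≤ c := Nat.pos_of_ne_zero hc
  have hp1 : 1 ≤ p := hp.one_lt.le
  -- `p ^ v_p(abc)` lies below one of `a, b, c`
  have hle : p ^ (a * b * c).factorization p ≤ a ∨ p ^ (a * b * c).factorization p ≤ b ∨
      p ^ (a * b * c).factorization p ≤ c := by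
    rw [Nat.factorization_mul (mul_ne_zero ha.ne' hb.ne') hc, Nat.factorization_mul ha.ne' hb.ne']
    simp only [Finsupp.coe_add, Pi.add_apply]
    rcases TowerFourGivesDepthCounted.factorization_eq_zero_or hcop p with h1 | h1 <;>
    rcases TowerFourGivesDepthCounted.factorization_eq_zero_or hac p with h2 | h2 <;>
    rcases TowerFourGivesDepthCounted.factorization_eq_zero_or hbc p with h3 | h3 <;>
    simp only [h1, h2, h3, zero_add, add_zero, pow_zero] <;>
    first
      | exact Or.inl ha1
      | exact Or.inl (Nat.ordProj_le p ha.ne')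
      | exact Or.inr (Or.inl (Nat.ordProj_le p hb.ne'))
      | exact Or.inr (Or.inr (Nat.ordProj_le p hc))
  rcases hle with h | h | h
  · calc c * p ^ (a * b * c).factorization p ≤ c * a := Nat.mul_le_mul_left c h
      _ = 1 * (a * 1 * c) := by ring
      _ ≤ p * (a * b * c) :=
        Nat.mul_le_mul hp1 (Nat.mul_le_mul_right c (Nat.mul_le_mul_left a hb1))
  · calc c * p ^ (a * b * c).factorization p ≤ c * b := Nat.mul_le_mul_left c h
      _ = 1 * (1 * b * c) := by ring
      _ ≤ p * (a * b * c) :=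
        Nat.mul_le_mul hp1 (Nat.mul_le_mul_right c (Nat.mul_le_mul_right b ha1))
  · have hab : c ≤ 2 * (a * b) := by
      have h1 : a ≤ a * b := Nat.le_mul_of_pos_right a hb
      have h2 : b ≤ a * b := Nat.le_mul_of_pos_left b ha
      omega
    calc c * p ^ (a * b * c).factorization p ≤ c * c := Nat.mul_le_mul_left c h
      _ ≤ c * (p * (a * b)) := Nat.mul_le_mul_left c (hab.trans (Nat.mul_le_mul_right _ hp.two_le))
      _ = p * (a * b * c) := by ring

/-! ## The bracket bound at budget `K ≤ 1` -/

/-- **The integer form of the rung at `K ≤ 1`:** for an abc triple and a set `S` of at most one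
prime, `c ≤ (∏_{p ∈ S} p) · {abc}^S`. [folklore] -/
theorem levelOneOne_le_bracket {a b c : ℕ} (habc : IsABCTriple a b c) {S : Finset ℕ}
    (hcard : S.card ≤ 1) (hprime : ∀ p ∈ S, Nat.Prime p) :
    c ≤ (∏ p ∈ S, p) * ∏ p ∈ (a * b * c).primeFactors \ S, p ^ (a * b * c).factorization p := by
  have hM : a * b * c ≠ 0 := by
    obtain ⟨ha, hb, hsum, -⟩ := habc
    exact mul_ne_zero (mul_ne_zero ha.ne' hb.ne') (by omega)
  rcases S.eq_empty_or_nonempty with rfl | hne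
  · rw [UniformSadicGivesTowerFour.bracket_empty hM]
    exact Nat.le_mul_of_pos_left c (Nat.pos_of_ne_zero (by
      obtain ⟨ha, hb, -, -⟩ := habc
      exact mul_ne_zero ha.ne' hb.ne'))
  · obtain ⟨p, rfl⟩ := Finset.card_eq_one.1 (le_antisymm hcard (Finset.card_pos.2 hne))
    have hp : p.Prime := hprime p (Finset.mem_singleton_self p)
    rw [Finset.prod_singleton]
    refine Nat.le_of_mul_le_mul_right (c := p ^ (a * b * c).factorization p) ?_ (pow_pos hp.pos _)
    calc c * p ^ (a * b * c).factorization p ≤ p * (a * b * c) := levelOneOne_key habc hp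
      _ = p * ((∏ r ∈ (a * b * c).primeFactors \ {p}, r ^ (a * b * c).factorization r) *
            p ^ (a * b * c).factorization p) := by rw [levelOneOne_sdiff_singleton_mul hM p]
      _ = p * (∏ r ∈ (a * b * c).primeFactors \ {p}, r ^ (a * b * c).factorization r) *
            p ^ (a * b * c).factorization p := (mul_assoc _ _ _).symm

/-- **From the integer bound to the rung:** if `0 < c ≤ B` then `c < 2 · B^(1+ε)` for every
`ε > 0` (`B ≥ 1`, so `B ≤ B^(1+ε)`). [folklore] -/
theorem levelOneOne_real {c B : ℕ} (hc : 0 < c) (hle : c ≤ B) {ε : ℝ} (hε : 0 < ε) :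
    (c : ℝ) < 2 * ((B : ℕ) : ℝ) ^ (1 + ε) := by
  have hcR : (0 : ℝ) < c := by exact_mod_cast hc
  have hleR : (c : ℝ) ≤ (B : ℝ) := by exact_mod_cast hle
  have hB1 : (1 : ℝ) ≤ (B : ℝ) := by exact_mod_cast hc.trans_le hle
  calc (c : ℝ) < 2 * (c : ℝ) := by linarith
    _ ≤ 2 * (B : ℝ) := by linarith
    _ ≤ 2 * (B : ℝ) ^ (1 + ε) := by
      gcongr
      exact Real.self_le_rpow_of_one_le hB1 (by linarith)

/-! ## The stub -/

/-- **stub_levelOneRung_one (the level-one rung is TRIVIAL at budget `K ≤ 1`).** For every abc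
triple and every set `S` of at most one prime, `c ≤ (∏_{p∈S} p) · {abc}^S` (pairwise
coprimality: the one prime of `S` divides at most one of `a, b, c`; `a + b ≤ 2ab`, `p ≥ 2`), hence
`c < 2 · ((∏_{p∈S} p) · {abc}^S)^(1+ε)`; so `C = 2` serves for every `ε > 0`. (The rung first
becomes hard at `K = 2`: `stub_primeHall_of_levelOneTwo`.) [folklore] -/
theorem stub_levelOneRung_one :
    ∀ ε : ℝ, 0 < ε → ∃ C : ℝ, 0 < C ∧ ∀ S : Finset ℕ, S.card ≤ 1 → (∀ p ∈ S, Nat.Prime p) →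
      ∀ a b c : ℕ, IsABCTriple a b c →
        (c : ℝ) < C * ((((∏ p ∈ S, p) *
          ∏ p ∈ (a * b * c).primeFactors \ S, p ^ (a * b * c).factorization p : ℕ) : ℝ)) ^ (1 + ε) := by
  intro ε hε
  refine ⟨2, two_pos, fun S hcard hprime a b c habc => ?_⟩
  have hc : 0 < c := by
    obtain ⟨ha, -, hsum, -⟩ := habc
    omega
  exact levelOneOne_real hc (levelOneOne_le_bracket habc hcard hprime) hε

end Summit.ABC.ABC.Theorems.UniformSadicTowerFour.MixedRadical
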